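import Summits.BirchSwinnertonDyer.BirchSwinnertonDyer.Theses.UniversalToricDescent

/-!
# Sketch — crux idea `fern-closure` (ideation g37, item 20395 `AdditiveSplitIMCInclusionAtThree`)

The additive newform `f_E` (supercuspidal at 3, `U₃ f_E = 0`) lies on NO 3-adic family, but the wall
`𝓛 ∈ Fitt_Λ X_{∅,0}` is a CLOSED condition on the `ρ̄`-component of the big 3-adic Hecke algebra of tame
level `M′ = N/3^{c}`: both sides are 3-adically continuous in the eigenform (the `(∅,0)` local conditions are
Galois-theoretic, the BDP measure is a continuous linear functional of the 3-depleted form on the ordinary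
CM locus), so it suffices to prove the wall at finite-slope (crystalline-at-3) NEIGHBOURS `g_n ≡ f_E (mod 3ⁿ)`
with a uniform constant — there the anticyclotomic Heegner tower is coherent (`a₃(g_n) ≠ 0`), i.e. the
TraceZero barrier is a property of the limit point only — and pass to the limit by Krull.

* §1 (PROVED, pure Mathlib) the closing engine: `mem_of_forall_mem_sup_span_pow` (a Fitting-ideal membership
  that holds modulo `pⁿ` for every `n` holds: Krull intersection, `p` in the Jacobson radical) and
  `neighbourTransport` (the transport schema with auxiliary `Σ_n`-Euler factors `Q_n` coprime to `p`:
  per-`n` data `J_n + (pⁿ) = Q_n·I + (pⁿ)`, `M_n ∈ J_n`, `M_n ≡ p^c Q_n L (mod pⁿ)` force `p^c L ∈ I`).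
* §2 (TYPED over tree vocabulary, template `Skinner2016.HidaCongruentForm` with the ordinarity field dropped
  and the level made prime to `p`): `CrystallineNeighbour W p n` and the crux `FernAccumulationAtThree`
  (K1: class-O6 curves with `ρ̄₃` onto have crystalline-at-3 newform neighbours modulo every `3ⁿ`).
Nothing here is asserted as a fact; §2 is a hypothesis structure + a `Prop`.
-/

open scoped MatrixGroups ModularForm
open CongruenceSubgroup Field UpperHalfPlane
open Literature Literature.NumberTheory Literature.NumberTheory.EllipticCurves
open Literature.NumberTheory.GaloisRepresentations
open Literature.NumberTheory.EllipticCurves.ModularForms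
open Literature.NumberTheory.EllipticCurves.GreenbergSelmer

set_option linter.dupNamespace false

namespace Summit.BirchSwinnertonDyer.BirchSwinnertonDyer.Cruxes.AdditiveSplitIMCInclusionAtThree.FernClosure

/-! ## §1 The closing engine (proved) -/

/-- **Fitting-membership is closed.** In a Noetherian ring, if `p` lies in the Jacobson radical then
`⋂ₙ (I + (pⁿ)) = I`: an element lying in `I + (pⁿ)` for every `n` lies in `I` (Krull's intersection theorem
for the finite module `R ⧸ I`). -/
theorem mem_of_forall_mem_sup_span_pow {R : Type*} [CommRing R] [IsNoetherianRing R] {p : R}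
    (hp : p ∈ (⊥ : Ideal R).jacobson) (I : Ideal R) (x : R)
    (hx : ∀ n : ℕ, x ∈ I ⊔ Ideal.span {p ^ n}) : x ∈ I := by
  have hle : Ideal.span {p} ≤ (⊥ : Ideal R).jacobson := (Ideal.span_singleton_le_iff_mem _).mpr hp
  have hy : Ideal.Quotient.mk I x ∈ (⨅ i : ℕ, (Ideal.span {p}) ^ i • ⊤ : Submodule R (R ⧸ I)) := by
    refine Submodule.mem_iInf _ |>.mpr fun n => ?_
    obtain ⟨a, ha, b, hb, hab⟩ := Submodule.mem_sup.mp (hx n)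
    obtain ⟨r, rfl⟩ := Ideal.mem_span_singleton.mp hb
    have hxb : Ideal.Quotient.mk I x = Ideal.Quotient.mk I (p ^ n * r) := by
      rw [Ideal.Quotient.eq]
      have : x - p ^ n * r = a := by rw [← hab]; ring
      rw [this]; exact ha
    rw [hxb, map_mul, ← Ideal.Quotient.algebraMap_eq, ← Algebra.smul_def]
    exact Submodule.smul_mem_smul (Ideal.pow_mem_pow (Ideal.mem_span_singleton_self p) n)
      Submodule.mem_top
  rw [Ideal.iInf_pow_smul_eq_bot_of_le_jacobson _ hle, Submodule.mem_bot] at hy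
  exact Ideal.Quotient.eq_zero_iff_mem.mp hy

/-- **Neighbour transport.** `R` a Noetherian domain, `p` a prime element in the Jacobson radical (e.g.
`R = Λ = ℤ₃⟦T⟧`, `p = 3`), `I ⊆ R` (the Fitting ideal of `X_{∅,0}(E)`), `L ∈ R` (the BDP element of `E`).
Suppose for every `n` there are an ideal `J` (the Fitting ideal of the `Σ_n`-imprimitive dual Selmer module of a
depth-`n` neighbour `g_n`), an element `Q` prime to `p` (the product of the `Σ_n`-Euler factors of `E`, `μ = 0`)
and `M ∈ J` (`= p^c·𝓛^{Σ_n}(g_n)`, the neighbour's inclusion with uniform exponent `c`) with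
`J + (pⁿ) = Q·I + (pⁿ)` (reduction-blind control mod `pⁿ`) and `M ≡ p^c·Q·L (mod pⁿ)` (congruence of depleted
CM-point measures mod `pⁿ`). Then `p^c·L ∈ I`. -/
theorem neighbourTransport {R : Type*} [CommRing R] [IsDomain R] [IsNoetherianRing R] {p : R}
    (hp : Prime p) (hpJ : p ∈ (⊥ : Ideal R).jacobson) (I : Ideal R) (L : R) (c : ℕ)
    (h : ∀ n : ℕ, ∃ (J : Ideal R) (Q M : R), ¬ p ∣ Q ∧
      J ⊔ Ideal.span {p ^ n} = Ideal.span {Q} * I ⊔ Ideal.span {p ^ n} ∧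
      M ∈ J ∧ M - p ^ c * Q * L ∈ Ideal.span {p ^ n}) :
    p ^ c * L ∈ I := by
  apply mem_of_forall_mem_sup_span_pow hpJ I
  intro n
  obtain ⟨J, Q, M, hQ, hJ, hM, hML⟩ := h n
  have h1 : p ^ c * Q * L ∈ J ⊔ Ideal.span {p ^ n} := by
    have : p ^ c * Q * L = M - (M - p ^ c * Q * L) := by ring
    rw [this]
    exact Submodule.sub_mem _ (Submodule.mem_sup_left hM) (Submodule.mem_sup_right hML)
  rw [hJ] at h1
  obtain ⟨a, ha, b, hb, hab⟩ := Submodule.mem_sup.mp h1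
  obtain ⟨z, hz, rfl⟩ := Ideal.mem_span_singleton_mul.mp ha
  obtain ⟨r, rfl⟩ := Ideal.mem_span_singleton.mp hb
  have h2 : p ^ n ∣ Q * (p ^ c * L - z) := ⟨r, by linear_combination (-1 : R) * hab⟩
  have h3 : p ^ n ∣ p ^ c * L - z := hp.pow_dvd_of_dvd_mul_left n hQ h2
  have : p ^ c * L = z + (p ^ c * L - z) := by ring
  rw [this]
  exact Submodule.add_mem_sup hz (Ideal.mem_span_singleton.mpr h3)

/-! ## §2 The new crux, typed: crystalline neighbours of the additive curve modulo `3ⁿ` -/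

/-- The prime-to-`p` part of the conductor (`M′ = N / p^{v_p(N)}`), the tame level of the neighbours. -/
noncomputable def tameConductor (W : WeierstrassCurve ℚ) [W.IsGloballyMinimal] (p : ℕ) : ℕ :=
  W.conductorNorm ℤ / p ^ (padicValNat p (W.conductorNorm ℤ))

/-- **A crystalline (finite-slope) neighbour of `E` at depth `n`** — the template
`Skinner2016.HidaCongruentForm W p m` with the ordinarity field `norm_coeff_p` DROPPED and the level made
PRIME TO `p`: a weight `k ≥ 2`, a newform `g ∈ S_k(Γ₀(M′))`, `M′ = N/p^{v_p N}` (so `ρ_g|G_{ℚ_p}` is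
crystalline of Hodge–Tate weights `(0, k−1)` and of finite slope), a `p`-adic embedding `ι` of its coefficient
field, and the congruence `|ι(a_ℓ(g)) − a_ℓ(E)|_p ≤ p^{−n}` at every prime `ℓ ∤ N`. A hypothesis structure;
its existence for all `n` is the crux `FernAccumulationAtThree`, NOT asserted. -/
structure CrystallineNeighbour (W : WeierstrassCurve ℚ) [W.IsGloballyMinimal] (p : ℕ) [Fact p.Prime]
    (n : ℕ) where
  /-- the weight `k_n` -/
  k : ℤ
  /-- `k_n ≥ 2` -/
  two_le_k : 2 ≤ k
  /-- the neighbour `g_n ∈ S_{k_n}(Γ₀(M′))`, `p ∤ M′` -/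
  g : CuspForm (Gamma0 (tameConductor W p)) k
  /-- `g_n` is a newform of level `M′` -/
  isNewform : ∀ [NeZero (tameConductor W p)], IsNewform0 g
  /-- a `p`-adic embedding of the coefficient field `K_{g_n}` -/
  ι : coeffField g →+* PadicAlgCl p
  /-- `a_ℓ(g_n) ≡ a_ℓ(E) (mod pⁿ)` at every prime `ℓ ∤ N` -/
  norm_coeff_sub_le : ∀ ℓ : ℕ, ℓ.Prime → ¬ ℓ ∣ W.conductorNorm ℤ →
    ‖ι ⟨(qExpansion 1 ⇑g).coeff ℓ, coeff_mem_coeffField g ℓ⟩ - ((W.frobeniusTrace ℓ : ℤ) : PadicAlgCl p)‖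
      ≤ ((p : ℝ) ^ n)⁻¹

/-- **Crux K1 (`FernAccumulationAtThree`): analytic accumulation of the infinite fern at the additive
point.** For every globally minimal elliptic `W/ℚ` in the rank-one residual class O6 at `p = 3` (additive,
potentially supersingular, `3` split in the Heegner field) with `ρ̄_{E,3}` onto `GL₂(𝔽₃)`, and every `n`,
there is a crystalline-at-3 newform neighbour of depth `n`. Zariski density of such points is Gouvêa–Mazur /
Böckle (global) and Kisin 2010 Thm. 0.3 (local); accumulation at a NON-trianguline (supercuspidal) point is
beyond print (Khare–Ramakrishna 2015 lift `ρ mod pⁿ` only in the ordinary case). -/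
def FernAccumulationAtThree : Prop :=
  ∀ (W : WeierstrassCurve ℚ) [W.IsElliptic] [W.IsGloballyMinimal],
    Summit.BirchSwinnertonDyer.Rank1Residual.Additive.ClassO6 W 3 → W.HasSurjectiveModNGaloisRep 3 →
      ∀ n : ℕ, Nonempty (CrystallineNeighbour W 3 n)

end Summit.BirchSwinnertonDyer.BirchSwinnertonDyer.Cruxes.AdditiveSplitIMCInclusionAtThree.FernClosure
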